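import Literature.AlgebraicGeometry.Resolution.QuadraticTransformsStructure
import Literature.AlgebraicGeometry.Resolution.RegularLocalRingsProofs
import Literature.AlgebraicGeometry.Resolution.RegularSystemOfParameters
import Mathlib.RingTheory.RegularLocalRing.Defs
import Mathlib.Data.Set.Card
import HarnessLib

/-!
# Steer / LEMMA I kernel, file F2: THE CHART OF THE POINT STEP — exceptional parameter, adapted regular system of parameters, domination,
# the rational case (A) and the linear-independence clause (LI₁)

OURS (campaign res-hironaka, rung L ★L-G4, slot W4.1, crux `Steer` stmt-ResolutionOfSingularities-16345; res-L0-w41-plan-1 RULING 155a, kernel of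
res-L0-w41-idea-3's LEMMA I `InsepStepNotIsolated`; res-L0-w41-stub-3 g7, blueprint `KERNEL-BLUEPRINT-LemmaI.md` 693d33707585fe97 §0–§1; replaces the
role of no printed item; NOT a statement of the manuscript under review [claim: Hironaka2017, status: under-review]; AI review is weaker than expert
review). Theses-free, definition-free. Pure commutative algebra of one quadratic transform `S₀ ≤ S₁` of local subrings of a field `L`
(`Literature.AlgebraicGeometry.Resolution.IsQuadraticTransform`, Cutkosky §2.1):

* §1 domination bookkeeping (`inclusion_mem_maximalIdeal_iff`, units of `S₀` stay units);
* §2 the exceptional parameter: `𝔪₀ S₁ ⊆ X S₁` (`inclusion_mem_span_exc`), `X ∉ 𝔪₀²` is the tree's `IsQuadraticTransform.chart_not_mem_sq`, and in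
  embedding dimension `3` the parameter `X` extends to a minimal system of generators `𝔪₀ = (X, Y, Z)` (`exists_span_triple_eq_maximalIdeal`, tree
  `exists_span_insert_eq_maximalIdeal`); the ADAPTED change `Z ↦ Z − cX − eY` keeps it one (`span_triple_sub_eq`);
* §3 the blow-up ring `S₀[𝔪₀/X] = S₀[Y/X, Z/X]` and the congruence «every element of `S₀[𝔪₀/X]` is congruent mod `𝔪₁` to an element of `S₀`» when the
  near point is RATIONAL (`exists_eq_add_of_rational`) — the rational case (A) contradicts residue-field growth (`false_of_rational_of_growth`);
* §4 the clause (LI₁) «`a + b·t ∈ 𝔪₁ ⇒ a, b ∈ 𝔪₀`» when `t̄ ∉ κ₀` (`mem_and_mem_of_add_mul_mem`).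
[cite: Cutkosky2014, §2.1] [cite: Matsumura1987, Thm. 2.3] [folklore]
-/

noncomputable section

-- single-problem summit: the doubled namespace component `ResolutionOfSingularities` is forced
set_option linter.dupNamespace false

namespace Summit.ResolutionOfSingularities.ResolutionOfSingularities.Theorems.SwitchingDichotomy.LemmaI

open IsLocalRing Literature.AlgebraicGeometry.Resolution

variable {L : Type} [Field L]

/-! ## §1 Domination bookkeeping -/

section Domination

variable {S₀ S₁ : Subring L} [IsLocalRing S₀] [IsLocalRing S₁]

/-- Along a dominant inclusion `S₀ ≤ S₁` of local subrings of `L`, an element of `S₀` lies in `𝔪₁` iff it lies in `𝔪₀`. [cite: Cutkosky2014, §2.1] -/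
theorem inclusion_mem_maximalIdeal_iff (hdom : SubringDominates S₀ S₁) (a : S₀) :
    Subring.inclusion hdom.1 a ∈ maximalIdeal S₁ ↔ a ∈ maximalIdeal S₀ := by
  rw [mem_maximalIdeal_iff_inv_not_mem, mem_maximalIdeal_iff_inv_not_mem, Subring.coe_inclusion]
  constructor
  · rintro (h0 | hni)
    · exact Or.inl h0
    · exact Or.inr fun hinv => hni (hdom.1 hinv)
  · rintro (h0 | hni)
    · exact Or.inl h0
    · exact Or.inr fun hinv => hni (hdom.2 _ a.2 hinv)

/-- A unit of `S₁` coming from `S₀` is a unit of `S₀` (domination), so its inverse in `L` lies in `S₀`. [cite: Cutkosky2014, §2.1] -/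
theorem inv_mem_of_not_mem_maximalIdeal (hdom : SubringDominates S₀ S₁) {a : S₀}
    (ha : Subring.inclusion hdom.1 a ∉ maximalIdeal S₁) : (a : L)⁻¹ ∈ S₀ := by
  rw [inclusion_mem_maximalIdeal_iff hdom, mem_maximalIdeal_iff_inv_not_mem, not_or, not_not] at ha
  exact ha.2

/-- An element of a local subring outside the maximal ideal is non-zero with inverse in the subring. [folklore] -/
theorem inv_mem_of_not_mem_maximalIdeal' {z : S₁} (hz : z ∉ maximalIdeal S₁) : (z : L) ≠ 0 ∧ (z : L)⁻¹ ∈ S₁ := by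
  rw [mem_maximalIdeal_iff_inv_not_mem, not_or, not_not] at hz
  exact hz

end Domination

/-! ## §2 The exceptional parameter and the adapted regular system of parameters -/

section Exceptional

variable {S₀ S₁ : Subring L} [IsLocalRing S₀]

/-- `𝔪₀ S₁ ⊆ X S₁`: for `y ∈ 𝔪₀`, `y = X · (y / X)` with `y / X ∈ S₀[𝔪₀/X] ⊆ S₁`. [cite: Cutkosky2014, §2.1] -/
theorem inclusion_mem_span_exc (h : S₀ ≤ S₁) {X : S₀} (hB : blowupRing S₀ (X : L) ≤ S₁) (hX0 : (X : L) ≠ 0)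
    {y : S₀} (hy : y ∈ maximalIdeal S₀) : Subring.inclusion h y ∈ Ideal.span {Subring.inclusion h X} := by
  refine Ideal.mem_span_singleton'.mpr ⟨⟨(y : L) / X, hB (div_mem_blowupRing _ hy)⟩, Subtype.ext ?_⟩
  simp only [Subring.coe_mul, Subring.coe_inclusion]
  exact div_mul_cancel₀ _ hX0

/-- The extension of `𝔪₀` to `S₁` is contained in `(X)`. [cite: Cutkosky2014, §2.1] -/
theorem map_maximalIdeal_le_span_exc (h : S₀ ≤ S₁) {X : S₀} (hB : blowupRing S₀ (X : L) ≤ S₁) (hX0 : (X : L) ≠ 0) :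
    (maximalIdeal S₀).map (Subring.inclusion h) ≤ Ideal.span {Subring.inclusion h X} := by
  rw [Ideal.map_le_iff_le_comap]
  exact fun y hy => inclusion_mem_span_exc h hB hX0 hy

/-- **`X` extends to a minimal system of generators `𝔪₀ = (X, Y, Z)`** when `emb dim S₀ = 3` and `X ∈ 𝔪₀ ∖ 𝔪₀²` (tree
`exists_span_insert_eq_maximalIdeal`, Matsumura Thm. 2.3, plus a count). [cite: Matsumura1987, Thm. 2.3] -/
theorem exists_span_triple_eq_maximalIdeal [IsNoetherianRing S₀] (h3 : (maximalIdeal S₀).spanFinrank = 3) {X : S₀}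
    (hX : X ∈ maximalIdeal S₀) (hX2 : X ∉ maximalIdeal S₀ ^ 2) :
    ∃ Y Z : S₀, Ideal.span {X, Y, Z} = maximalIdeal S₀ := by
  classical
  obtain ⟨s, hsfin, hscard, hspan⟩ := exists_span_insert_eq_maximalIdeal hX hX2
  have hge : 3 ≤ (insert X s).ncard := by
    rw [← h3, ← hspan]
    exact Submodule.spanFinrank_span_le_ncard_of_finite (hsfin.insert X)
  have hle : (insert X s).ncard ≤ s.ncard + 1 := Set.ncard_insert_le X s
  have hs2 : s.ncard = 2 := by omega
  obtain ⟨Y, Z, -, rfl⟩ := Set.ncard_eq_two.mp hs2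
  exact ⟨Y, Z, hspan⟩

/-- The ADAPTED change of the last parameter: `(X, Y, Z − cX − eY)` generates the same ideal as `(X, Y, Z)`. [folklore] -/
theorem span_triple_sub_eq {R : Type*} [CommRing R] (X Y Z c e : R) :
    Ideal.span ({X, Y, Z - c * X - e * Y} : Set R) = Ideal.span {X, Y, Z} := by
  have hX₁ : X ∈ Ideal.span ({X, Y, Z - c * X - e * Y} : Set R) := Ideal.subset_span (by simp)
  have hY₁ : Y ∈ Ideal.span ({X, Y, Z - c * X - e * Y} : Set R) := Ideal.subset_span (by simp)
  have hZ₁ : Z - c * X - e * Y ∈ Ideal.span ({X, Y, Z - c * X - e * Y} : Set R) := Ideal.subset_span (by simp)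
  have hX₂ : X ∈ Ideal.span ({X, Y, Z} : Set R) := Ideal.subset_span (by simp)
  have hY₂ : Y ∈ Ideal.span ({X, Y, Z} : Set R) := Ideal.subset_span (by simp)
  have hZ₂ : Z ∈ Ideal.span ({X, Y, Z} : Set R) := Ideal.subset_span (by simp)
  apply le_antisymm
  · rw [Ideal.span_le]
    rintro w hw
    simp only [Set.mem_insert_iff, Set.mem_singleton_iff] at hw
    rcases hw with rfl | rfl | rfl
    · exact hX₂
    · exact hY₂
    · exact Ideal.sub_mem _ (Ideal.sub_mem _ hZ₂ (Ideal.mul_mem_left _ _ hX₂)) (Ideal.mul_mem_left _ _ hY₂)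
  · rw [Ideal.span_le]
    rintro w hw
    simp only [Set.mem_insert_iff, Set.mem_singleton_iff] at hw
    rcases hw with rfl | rfl | rfl
    · exact hX₁
    · exact hY₁
    · rw [SetLike.mem_coe]
      convert Ideal.add_mem _ (Ideal.add_mem _ hZ₁ (Ideal.mul_mem_left _ c hX₁)) (Ideal.mul_mem_left _ e hY₁) using 2
      ring

/-- Swapping the last two parameters. [folklore] -/
theorem span_triple_swap {R : Type*} [CommRing R] (X Y Z : R) :
    Ideal.span ({X, Z, Y} : Set R) = Ideal.span {X, Y, Z} := by
  rw [Set.pair_comm Z Y]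

/-- Members of `(X, Y, Z) = 𝔪₀`. [folklore] -/
theorem mem_of_span_triple_eq {R : Type*} [CommRing R] {I : Ideal R} {X Y Z : R} (h : Ideal.span {X, Y, Z} = I) :
    X ∈ I ∧ Y ∈ I ∧ Z ∈ I :=
  ⟨h ▸ Ideal.subset_span (by simp), h ▸ Ideal.subset_span (by simp), h ▸ Ideal.subset_span (by simp)⟩

/-- An element of `(X, Y, Z)` is `aX + bY + cZ`. [folklore] -/
theorem exists_eq_of_mem_span_triple {R : Type*} [CommRing R] {X Y Z m : R} (h : m ∈ Ideal.span ({X, Y, Z} : Set R)) :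
    ∃ a b c : R, m = a * X + b * Y + c * Z := by
  rw [Ideal.mem_span_insert] at h
  obtain ⟨a, m', hm', rfl⟩ := h
  rw [Ideal.mem_span_insert] at hm'
  obtain ⟨b, m'', hm'', rfl⟩ := hm'
  obtain ⟨c, rfl⟩ := Ideal.mem_span_singleton'.mp hm''
  exact ⟨a, b, c, by ring⟩

/-- The chart coordinates `t = Y/X`, `z' = Z/X` lie in `S₀[𝔪₀/X] ⊆ S₁`. [cite: Cutkosky2014, §2.1] -/
theorem div_mem_of_mem_maximalIdeal {X : S₀} (hB : blowupRing S₀ (X : L) ≤ S₁) {y : S₀} (hy : y ∈ maximalIdeal S₀) :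
    (y : L) / (X : L) ∈ S₁ :=
  hB (div_mem_blowupRing _ hy)

/-- `S₀[𝔪₀/X] = S₀[Y/X, Z/X]` as a closure, for `𝔪₀ = (X, Y, Z)`. [cite: Cutkosky2014, §2.1] -/
theorem blowupRing_eq_closure_triple {X Y Z : S₀} (h : Ideal.span {X, Y, Z} = maximalIdeal S₀) (hX0 : (X : L) ≠ 0) :
    blowupRing S₀ (X : L) = Subring.closure ((S₀ : Set L) ∪ {(Y : L) / X, (Z : L) / X}) := by
  rw [blowupRing_eq_closure_of_span_eq (X : L) ({X, Y, Z} : Set S₀) h]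
  apply le_antisymm
  · refine Subring.closure_le.mpr ?_
    rintro w (hw | ⟨y, hy, rfl⟩)
    · exact Subring.subset_closure (Or.inl hw)
    · rcases hy with rfl | rfl | rfl
      · change ((y : S₀) : L) / (y : L) ∈ _
        rw [div_self hX0]
        exact Subring.one_mem _
      · exact Subring.subset_closure (Or.inr (by simp))
      · exact Subring.subset_closure (Or.inr (by simp))
  · refine Subring.closure_mono ?_
    rintro w (hw | hw)
    · exact Or.inl hw
    · rcases hw with rfl | rfl
      · exact Or.inr ⟨Y, by simp, rfl⟩
      · exact Or.inr ⟨Z, by simp, rfl⟩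

end Exceptional

/-! ## §3 The rational case (A): no residue-field growth -/

section Rational

variable {S₀ S₁ : Subring L} [IsLocalRing S₀] [IsLocalRing S₁]

/-- If the chart coordinates `t = Y/X`, `z' = Z/X` are congruent mod `𝔪₁` to elements of `S₀` (the near point is `κ₀`-RATIONAL), then so is
every element of `S₀[Y/X, Z/X] = S₀[𝔪₀/X]`: `w = v + m`, `v ∈ S₀`, `m ∈ 𝔪₁` (closure induction). [folklore] -/
theorem exists_eq_add_of_rational (h : S₀ ≤ S₁) {X Y Z : S₀} (hXYZ : Ideal.span {X, Y, Z} = maximalIdeal S₀) (hX0 : (X : L) ≠ 0)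
    (ht : ∃ (a : S₀) (m : S₁), m ∈ maximalIdeal S₁ ∧ (Y : L) / X = a + m)
    (hz : ∃ (b : S₀) (m : S₁), m ∈ maximalIdeal S₁ ∧ (Z : L) / X = b + m) :
    ∀ w ∈ blowupRing S₀ (X : L), ∃ (v : S₀) (m : S₁), m ∈ maximalIdeal S₁ ∧ w = v + m := by
  intro w hw
  rw [blowupRing_eq_closure_triple hXYZ hX0] at hw
  induction hw using Subring.closure_induction with
  | mem w hw =>
    rcases hw with hw | hw
    · exact ⟨⟨w, hw⟩, 0, zero_mem _, by simp⟩
    · rcases hw with rfl | rfl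
      · exact ht
      · exact hz
  | zero => exact ⟨0, 0, zero_mem _, by simp⟩
  | one => exact ⟨1, 0, zero_mem _, by simp⟩
  | add u w _ _ ihu ihw =>
    obtain ⟨a, m, hm, rfl⟩ := ihu
    obtain ⟨b, n, hn, rfl⟩ := ihw
    exact ⟨a + b, m + n, Ideal.add_mem _ hm hn, by push_cast; ring⟩
  | neg u _ ihu =>
    obtain ⟨a, m, hm, rfl⟩ := ihu
    exact ⟨-a, -m, Submodule.neg_mem _ hm, by push_cast; ring⟩
  | mul u w _ _ ihu ihw =>
    obtain ⟨a, m, hm, rfl⟩ := ihu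
    obtain ⟨b, n, hn, rfl⟩ := ihw
    refine ⟨a * b, Subring.inclusion h a * n + m * Subring.inclusion h b + m * n,
      Ideal.add_mem _ (Ideal.add_mem _ (Ideal.mul_mem_left _ _ hn) (Ideal.mul_mem_right _ _ hm))
        (Ideal.mul_mem_right _ _ hm), ?_⟩
    push_cast [Subring.coe_inclusion]
    ring

/-- **The rational case (A) is impossible under residue-field growth.** If `t̄, z̄' ∈ κ₀` then every element of `S₁` — a fraction `a/b`
of elements of `S₀[𝔪₀/X]` with `b` a unit — is congruent mod `𝔪₁` to an element of `S₀` (`a = v_a + m_a`, `b = v_b + m_b` with `v_b ∈ S₀ˣ` by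
domination, and `a/b − v_a/v_b = (m_a v_b − v_a m_b)/(b v_b)`), contradicting `hgrow`. [folklore] -/
theorem false_of_rational_of_growth (hQT : IsQuadraticTransform S₀ S₁) (h : S₀ ≤ S₁) {X Y Z : S₀}
    (hXYZ : Ideal.span {X, Y, Z} = maximalIdeal S₀) (hX0 : (X : L) ≠ 0) (hB : blowupRing S₀ (X : L) ≤ S₁)
    (hfrac : ∀ w ∈ S₁, ∃ a ∈ blowupRing S₀ (X : L), ∃ b ∈ blowupRing S₀ (X : L), b⁻¹ ∈ S₁ ∧ w = a / b)
    (ht : ∃ (a : S₀) (m : S₁), m ∈ maximalIdeal S₁ ∧ (Y : L) / X = a + m)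
    (hz : ∃ (b : S₀) (m : S₁), m ∈ maximalIdeal S₁ ∧ (Z : L) / X = b + m)
    (hgrow : ∃ u : S₁, ∀ v : S₀, u - ⟨(v : L), h v.2⟩ ∉ maximalIdeal S₁) : False := by
  have hdom : SubringDominates S₀ S₁ := hQT.dominates
  obtain ⟨u, hu⟩ := hgrow
  obtain ⟨a, ha, b, hb, hbinv, hub⟩ := hfrac u u.2
  have key := exists_eq_add_of_rational h hXYZ hX0 ht hz
  obtain ⟨va, ma, hma, hava⟩ := key a ha
  obtain ⟨vb, mb, hmb, hbvb⟩ := key b hb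
  -- `b ≠ 0`
  have hb0 : b ≠ 0 := by
    rintro rfl
    refine hu 0 ?_
    have : u - ⟨((0 : S₀) : L), h (0 : S₀).2⟩ = 0 := Subtype.ext (by simp [hub])
    rw [this]
    exact zero_mem _
  -- `vb ∉ 𝔪₁`, hence `vb ∈ S₀ˣ`
  have hvb1 : Subring.inclusion h vb ∉ maximalIdeal S₁ := by
    intro hmem
    have hbm : (⟨b, hB hb⟩ : S₁) ∈ maximalIdeal S₁ := by
      have : (⟨b, hB hb⟩ : S₁) = Subring.inclusion h vb + mb := Subtype.ext (by simpa using hbvb)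
      rw [this]
      exact Ideal.add_mem _ hmem hmb
    rw [mem_maximalIdeal_iff_inv_not_mem] at hbm
    rcases hbm with h0 | hni
    · exact hb0 h0
    · exact hni hbinv
  have hvbinv : (vb : L)⁻¹ ∈ S₀ := inv_mem_of_not_mem_maximalIdeal hdom hvb1
  have hvb0 : (vb : L) ≠ 0 := by
    intro h0
    apply hvb1
    have : Subring.inclusion h vb = 0 := Subtype.ext (by simpa using h0)
    rw [this]
    exact zero_mem _
  -- the candidate `v = va · vb⁻¹`
  refine hu (va * ⟨(vb : L)⁻¹, hvbinv⟩) ?_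
  have hexpr : u - ⟨((va * ⟨(vb : L)⁻¹, hvbinv⟩ : S₀) : L), h (va * ⟨(vb : L)⁻¹, hvbinv⟩).2⟩ =
      (ma * Subring.inclusion h vb - Subring.inclusion h va * mb) * ⟨b⁻¹, hbinv⟩ *
        Subring.inclusion h ⟨(vb : L)⁻¹, hvbinv⟩ := by
    apply Subtype.ext
    simp only [Subring.coe_mul, Subring.coe_inclusion, AddSubgroupClass.coe_sub]
    rw [hub, hava, hbvb]
    rw [hbvb] at hb0
    field_simp
    ring
  rw [hexpr]
  refine Ideal.mul_mem_right _ _ (Ideal.mul_mem_right _ _ ?_)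
  exact Ideal.sub_mem _ (Ideal.mul_mem_right _ _ hma) (Ideal.mul_mem_left _ _ hmb)

end Rational

/-! ## §4 The clause (LI₁): `a + b t ∈ 𝔪₁ ⇒ a, b ∈ 𝔪₀` when `t̄ ∉ κ₀` -/

section LI

variable {S₀ S₁ : Subring L} [IsLocalRing S₀] [IsLocalRing S₁]

/-- **(LI₁).** If the class of `t ∈ S₁` is NOT in the image of `κ₀` (`∀ a, t − a ∉ 𝔪₁`), then `a + b·t ∈ 𝔪₁` with `a, b ∈ S₀` forces
`a, b ∈ 𝔪₀`: were `b` a unit, `t − (−a/b) ∈ 𝔪₁`; so `b ∈ 𝔪₀ ⊆ 𝔪₁`, and then `a ∈ 𝔪₁ ∩ S₀ = 𝔪₀` by domination. [folklore] -/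
theorem mem_and_mem_of_add_mul_mem (hdom : SubringDominates S₀ S₁) (t : S₁)
    (ht : ∀ a : S₀, t - Subring.inclusion hdom.1 a ∉ maximalIdeal S₁) (a b : S₀)
    (hab : Subring.inclusion hdom.1 a + Subring.inclusion hdom.1 b * t ∈ maximalIdeal S₁) :
    a ∈ maximalIdeal S₀ ∧ b ∈ maximalIdeal S₀ := by
  set ι := Subring.inclusion hdom.1
  have hb : b ∈ maximalIdeal S₀ := by
    by_contra hbu
    have hbunit : IsUnit b := by
      by_contra h'
      exact hbu ((mem_maximalIdeal _).mpr h')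
    obtain ⟨c, hc⟩ := hbunit.exists_left_inv
    have hcb : ι c * ι b = 1 := by rw [← map_mul, hc, map_one]
    apply ht (-(c * a))
    have : t - ι (-(c * a)) = ι c * (ι a + ι b * t) := by
      rw [map_neg, map_mul]
      linear_combination (-t) * hcb
    rw [this]
    exact Ideal.mul_mem_left _ _ hab
  refine ⟨?_, hb⟩
  have hb1 : ι b * t ∈ maximalIdeal S₁ := Ideal.mul_mem_right _ _ ((inclusion_mem_maximalIdeal_iff hdom b).mpr hb)
  have ha1 : ι a ∈ maximalIdeal S₁ := by
    have : ι a = (ι a + ι b * t) - ι b * t := by ring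
    rw [this]
    exact Ideal.sub_mem _ hab hb1
  exact (inclusion_mem_maximalIdeal_iff hdom a).mp ha1

end LI

end Summit.ResolutionOfSingularities.ResolutionOfSingularities.Theorems.SwitchingDichotomy.LemmaI

end
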